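import Summits.AtomisticToContinuum.HydrodynamicLimit.Theorems.TransferActivityTails.Negative.EquilibriumReduction
import Summits.AtomisticToContinuum.HydrodynamicLimit.Theorems.OneFlightGossipEngineCollisionActivityTailsEndpointTails
import Summits.AtomisticToContinuum.HydrodynamicLimit.Theorems.OneFlightGossipEngineEnergyCurrentTailsLevelCensusEventMeasurable
import Literature.Analysis.FluidPDE.EmpiricalCollisionMeasureMeasurableLabels
import HarnessLib

/-!
# A.e.-measurability of the block transfer activity (stub `stub_blockActAEMeasurable`)

Crux `Summit.AtomisticToContinuum.HydrodynamicLimit.Theses.TwoClocks.TransferActivityTails`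
(stmt-AtomisticToContinuum-16624), line `Sketch` (card `predictor-drift-doob`), registered stub
`stub_blockActAEMeasurable : BlockActAEMeasurable` (the defs `BlockAct`, `BlockActAEMeasurable` re-declared
verbatim from the line skeleton).

For `0 < σ < 1/2` the block transfer activity of the tagged sphere `i`,
`X_{i,j}(s) : z ↦ (σ/τ₁) Σ_{collisions of i in (s + j w₁, s + (j+1) w₁]} (‖v_i⁺ − v_i⁻‖ + |‖v_i⁺‖² − ‖v_i⁻‖²|/2)`,
`w₁ = τ₁ (N+1)^{-1/3}`, along the hard-sphere flow `Φ` is a.e.-measurable in the datum `z` under the local Gibbs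
law.  On the collisions of a good orbit (ordered contact pairs, `0 < ε = hsDiameter σ N`) the elastic law read off
the collision mark `(t, x, ω, v⁻, v_*⁻)` gives `v⁺ = v⁻ − ⟪v⁻ − v_*⁻, ω⟫ ω`
(`EnergyCurrentTailsLevelCensus.ofConfig_postVel_eq_of_mem_contactSet`), so `‖v⁺ − v⁻‖ = ‖⟪v⁻ − v_*⁻, ω⟫ ω‖`
and `|‖v⁺‖² − ‖v⁻‖²|/2 = |‖v⁻ − ⟪v⁻ − v_*⁻, ω⟫ ω‖² − ‖v⁻‖²|/2`; by `collisionSum_congr` the window collision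
sum of the crux's summand `transferOf N i` agrees on the good set with the label-dependent collision sum of the
CONTINUOUS mark functional
`F k l m = 𝟙{k = i} · (‖⟪m_v − m_{v*}, m_ω⟫ m_ω‖ + |‖m_v − ⟪m_v − m_{v*}, m_ω⟫ m_ω‖² − ‖m_v‖²|/2)`, and the
label-aware engine `HardSphereFlow.aemeasurable_of_eqOn_collisionSum_labels_torus` (`ε ≤ σ < 1/2`; the local
Gibbs law is carried by the good set, `ae_mem_good_localGibbsLaw`) concludes; the prefactor `σ/τ₁` is a
constant multiple.  Adapted from `TransferActivityTailsWeightedCountAEMeasurable.stub_weightedCountAEMeasurable`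
and the `hmeas` block of `ClampedCurrentsDockTransferTails.stub_transferActivityTails`.

References: I. Gallagher, L. Saint-Raymond, B. Texier, *From Newton to Boltzmann* (2013) §1.1, §4.1 (elastic law,
collision marks of the hard-sphere flow); C. Cercignani, R. Illner, M. Pulvirenti (1994) §4.2.
-/

noncomputable section

open MeasureTheory Filter Set Topology
open scoped ENNReal BigOperators InnerProductSpace

namespace Summit.AtomisticToContinuum.HydrodynamicLimit.Theorems.TransferActivityTailsDriftBlockActAEMeasurable

open Literature.MathematicalPhysics.KineticTheory Literature.Analysis.FluidPDE
open Summit.AtomisticToContinuum.HydrodynamicLimit.Theorems.TransferActivityTailsNegative (Flow Rec transferOf)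
open Summit.AtomisticToContinuum.HydrodynamicLimit.Theorems.CollisionActivityTailsEndpointTails
  (Cfg window ae_mem_good_localGibbsLaw)
open Summit.AtomisticToContinuum.HydrodynamicLimit.Theorems.EnergyCurrentTailsLevelCensus
  (ofConfig_postVel_eq_of_mem_contactSet)

/-! ## The statement (verbatim from the line skeleton) -/

/-- **Block transfer activity** `X_{i,j}(s)`: the crux's transfer activity of particle `i` restricted to the
`j`-th block `(s + j·w₁, s + (j+1)·w₁]`, `w₁ = window τ₁ N = τ₁ (N+1)^{-1/3}`, normalised per block (prefactor
`σ/τ₁`) (registered stub signature of line Sketch, crux TransferActivityTails (stmt-AtomisticToContinuum-16624)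
— route-internal, not a cited fact). -/
def BlockAct (σ τ₁ : ℝ) {N : ℕ} (Φ : Flow σ N) (i : Fin (N + 1)) (j : ℕ) (s : ℝ) (z : Cfg N) : ℝ :=
  σ / τ₁ * Φ.collisionSum (Set.Ioc (s + j * window τ₁ N) (s + (j + 1) * window τ₁ N)) (transferOf N i) z

/-- **a.e.-measurability of the block activity** under the local Gibbs law, for `0 < σ < 1/2` (the summand is a
continuous function of the ordered labels and the collision mark on a good orbit; the law is carried by the good
set) (registered stub signature of line Sketch, crux TransferActivityTails (stmt-AtomisticToContinuum-16624) —
route-internal, not a cited fact). -/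
def BlockActAEMeasurable : Prop :=
  ∀ (σ : ℝ), 0 < σ → σ < 2⁻¹ → ∀ (a₀ θ₀ : T3 → ℝ) (u₀ : T3 → V3) (N : ℕ) (Φ : Flow σ N) (τ₁ s : ℝ)
    (i : Fin (N + 1)) (j : ℕ), AEMeasurable (BlockAct σ τ₁ Φ i j s) (localGibbsLaw σ a₀ u₀ θ₀ N Φ)

/-! ## The proof -/

/-- The window collision sum of the crux's transfer summand `transferOf N i` over any window `(a, b]` is
a.e.-measurable in the datum under the local Gibbs law, for `0 < σ < 1/2`: on the collisions of a good orbit the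
summand is the continuous mark functional
`𝟙{k = i} · (‖⟪v⁻ − v_*⁻, ω⟫ ω‖ + |‖v⁻ − ⟪v⁻ − v_*⁻, ω⟫ ω‖² − ‖v⁻‖²|/2)` of the ordered labels and the mark
(elastic law `v⁺ = v⁻ − ⟪v⁻ − v_*⁻, ω⟫ ω` at contact), so the label-aware engine
`HardSphereFlow.aemeasurable_of_eqOn_collisionSum_labels_torus` applies (`hsDiameter σ N ≤ σ < 1/2`; the local
Gibbs law gives full mass to the good set). -/
theorem aemeasurable_collisionSum_transferOf {σ : ℝ} (hσ : 0 < σ) (hσ2 : σ < 2⁻¹) (a₀ θ₀ : T3 → ℝ)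
    (u₀ : T3 → V3) (N : ℕ) (Φ : Flow σ N) (a b : ℝ) (i : Fin (N + 1)) :
    AEMeasurable (fun z => Φ.collisionSum (Set.Ioc a b) (transferOf N i) z) (localGibbsLaw σ a₀ u₀ θ₀ N Φ) := by
  have hε : hsDiameter σ N < 2⁻¹ := (hsDiameter_le hσ.le N).trans_lt hσ2
  have hε0 : 0 < hsDiameter σ N := hsDiameter_pos hσ N
  -- the mark functional is continuous at fixed labels
  have hFc : ∀ k l : Fin (N + 1), Continuous fun m : ℝ × T3 × V3 × V3 × V3 =>
      if k = i then ‖⟪m.2.2.2.1 - m.2.2.2.2, m.2.2.1⟫_ℝ • m.2.2.1‖ +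
        |‖m.2.2.2.1 - ⟪m.2.2.2.1 - m.2.2.2.2, m.2.2.1⟫_ℝ • m.2.2.1‖ ^ 2 - ‖m.2.2.2.1‖ ^ 2| / 2 else 0 := by
    intro k l
    by_cases hk : k = i
    · simp only [hk, if_true]
      fun_prop
    · simp only [hk, if_false]
      exact continuous_const
  -- adapted from `TransferActivityTailsWeightedCountAEMeasurable.stub_weightedCountAEMeasurable`
  refine Φ.aemeasurable_of_eqOn_collisionSum_labels_torus hε hFc a b (fun z _ => ?_)
    (ae_mem_good_localGibbsLaw σ a₀ θ₀ u₀ N Φ)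
  rw [HardSphereFlow.collisionSum_eq, HardSphereFlow.collisionSum_eq]
  refine collisionSum_congr fun t _ p hp => ?_
  obtain ⟨-, hc⟩ := mem_contactPairs.1 hp
  by_cases hpi : p.1 = i
  · have hpost := congrArg Prod.fst (ofConfig_postVel_eq_of_mem_contactSet hε0 t hc)
    simp only [transferOf, HardSphereCollisionRecord.ofConfig_fst, HardSphereCollisionRecord.mark_def]
    rw [if_pos hpi, if_pos hpi, hpost, sub_sub_cancel_left, norm_neg]
  · simp only [transferOf, HardSphereCollisionRecord.ofConfig_fst]
    rw [if_neg hpi, if_neg hpi]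

/-- **Stub 2 (registered): the block activity is a.e.-measurable under the local Gibbs law** — the window
collision sum of `transferOf N i` over the `j`-th block is a.e.-measurable (`aemeasurable_collisionSum_transferOf`)
and the prefactor `σ/τ₁` is a constant multiple. -/
theorem stub_blockActAEMeasurable : BlockActAEMeasurable := by
  intro σ hσ hσ2 a₀ θ₀ u₀ N Φ τ₁ s i j
  exact (aemeasurable_collisionSum_transferOf hσ hσ2 a₀ θ₀ u₀ N Φ _ _ i).const_mul (σ / τ₁)

end Summit.AtomisticToContinuum.HydrodynamicLimit.Theorems.TransferActivityTailsDriftBlockActAEMeasurable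

end
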